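import Summits.Ventures.PercRepro.RLSRuleLineFreeArith
import Summits.Ventures.PercRepro.RLSGenericT3
import Summits.Ventures.PercRepro.RLSGenericT2
import Summits.Ventures.PercRepro.RLSGenericT1

/-!
# PercRepro — `R₃⁺` certifies EVERY line-free plane with `≥ 6` points, of EVERY type, at every `p ≥ 8`
(night-3, gen 3)

The certificate-lifting lane end to end, in the kernel, on the infinite family `U_{3,g}` (`g ≥ 6`): the geometry of
`RLSRuleLineFreeSupply.lean` (the witnesses `B′ ∪ X` and their shares, the demand bound), the bookkeeping of
`RLSRuleLineFreeArith.lean`, and the lane's LIFTED CERTIFICATES — the landed family theorems `U3.generic_t3`,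
`U2.generic_t2`, `U1.generic_t1` (`RLSGenericT{3,2,1}`, night-3 g0: the per-plane inequality of `R₃⁺` for `U_{3,g}`
at the types `t = 3, 2, 1`, every `g ≥ 6`, every `p = n + 4 ≥ 8`, proved from the closed forms by positivity):

* `phiK_eq_sum`: `Φ(n + 4, 3)` in the witness form of the family theorems;
* `perFlat_lineFree_type_three` / `_two` / `_one`: for a line-free plane `G` with `|G| ≥ 6` and `ρ(E ∖ G) = p − t`,
  the per-flat inequality at `(p, 3)`, `p ≥ 8`;
* **`perFlat_lineFree_of_six_le`** — for EVERY line-free plane with `≥ 6` points and every `p ≥ 8`, whatever the rank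
  of `E ∖ G`: `Φ(p, 3) · #U_G ≤ Σ_{S ∈ Yq} w⁺(G, S)` (`ρ(E ∖ G) ≥ p` is `perFlat_lineFree_of_typeZero`;
  `ρ(E ∖ G) < p − 3` has no bottom set at all).
With `perFlat_three_point` (`|G| = 3`, every `p`) this leaves, among the line-free planes, only `|G| ∈ {4, 5}` at the
types `t ≥ 1` to the per-plane tables.  Imports `RLSRuleLineFreeArith`, `RLSGenericT3`, `RLSGenericT2`, `RLSGenericT1`.
Axioms: standard.
-/

open scoped Matroid

namespace PercRepro

namespace NightThree

open Finset ThmH PerFlat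

variable {α : Type*} [DecidableEq α] {M : Matroid α} [M.Finite]

/-- `Φ(n + 4, 3)` in the witness form of the family theorems. -/
theorem phiK_eq_sum (n : ℕ) :
    phiK (n + 4) 3 = ∑ i ∈ range n, ((n + 4).choose (i + 1) : ℚ) / ((i + 4).choose 3 : ℚ) := by
  unfold phiK
  rw [phiW_eq_phiK_form n]
  rfl

/-- An independent subset `K ⊆ E ∖ G` with `|K| = ρ(E ∖ G)`. -/
theorem exists_indep_compl (G : Finset α) {e : ℕ} (he : M.eRk ((gr M \ G : Finset α) : Set α) = e) :
    ∃ K : Finset α, K ⊆ gr M \ G ∧ M.Indep (K : Set α) ∧ K.card = e := by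
  have hsubE : ((gr M \ G : Finset α) : Set α) ⊆ M.E := by
    rw [← coe_gr M]
    exact Finset.coe_subset.2 Finset.sdiff_subset
  obtain ⟨I, hI⟩ := M.exists_isBasis _ hsubE
  have hIfin : I.Finite := (gr M \ G).finite_toSet.subset hI.subset
  refine ⟨hIfin.toFinset, ?_, ?_, ?_⟩
  · rw [← Finset.coe_subset, hIfin.coe_toFinset]
    exact hI.subset
  · rw [hIfin.coe_toFinset]
    exact hI.indep
  · have h1 := hI.encard_eq_eRk
    rw [he, ← hIfin.coe_toFinset, Set.encard_coe_eq_coe_finsetCard] at h1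
    exact_mod_cast h1

/-- The common core of the three types: the supply bound grouped by size, with `|K| = k`. -/
theorem supply_ge_grouped {G : Finset α} (hG : G ∈ flatsQ M 3) (hfree : LineFree M G) (hg : 6 ≤ G.card)
    {k n : ℕ} (he : M.eRk ((gr M \ G : Finset α) : Set α) = k) :
    (G.card.choose 3 : ℚ) * (∑ i ∈ range n, (k.choose (i + 1) : ℚ) / ((i + 4).choose 3 : ℚ)) +
        4 * (G.card.choose 4 : ℚ) * (∑ i ∈ range n, (k.choose (i + 1) : ℚ) / ((i + 5).choose 3 : ℚ)) +
        10 * (G.card.choose 5 : ℚ) * (∑ i ∈ range n, (k.choose (i + 1) : ℚ) / ((i + 6).choose 3 : ℚ)) +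
        (2 ^ G.card - 1 - (G.card : ℚ) - (G.card.choose 2 : ℚ) - (G.card.choose 3 : ℚ) - (G.card.choose 4 : ℚ) -
          (G.card.choose 5 : ℚ)) * (∑ i ∈ range n, (k.choose (i + 1) : ℚ)) ≤
      ∑ S ∈ Yq M (n + 4) 3, wPlus M G S := by
  obtain ⟨K, hKsub, hKind, hKcard⟩ := exists_indep_compl G he
  have hsup := supply_ge_of_lineFree hG hfree hKsub hKind n
  rw [Finset.sum_powerset_apply_card (fun b => ∑ i ∈ range n, (K.card.choose (i + 1) : ℚ) * lbShare b (i + 1))]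
    at hsup
  simp only [nsmul_eq_mul] at hsup
  rw [sum_powerset_lbShare hg, hKcard] at hsup
  exact hsup

/-- **Type `3`** (`ρ(E ∖ G) = p − 3`): the per-flat inequality for a line-free plane with `≥ 6` points, `p ≥ 8`. -/
theorem perFlat_lineFree_type_three {G : Finset α} (hG : G ∈ flatsQ M 3) (hfree : LineFree M G)
    (hg : 6 ≤ G.card) {n : ℕ} (hn : 4 ≤ n) (he : M.eRk ((gr M \ G : Finset α) : Set α) = ((n + 1 : ℕ) : ℕ∞)) :
    phiK (n + 4) 3 * ((UqG M (n + 4) 3 G).card : ℚ) ≤ ∑ S ∈ Yq M (n + 4) 3, wPlus M G S := by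
  have hdem := card_UqG_le_of_eRk_compl G he (show n + 1 + 3 ≤ n + 4 by omega)
  rw [demandCount_eq (by omega)] at hdem
  simp only [Finset.sum_range_succ, Finset.range_zero, Finset.sum_empty, Nat.choose_zero_right,
    Nat.choose_one_right, Nat.cast_one, zero_add] at hdem
  have hsup := supply_ge_grouped hG hfree hg (n := n) he
  have hfam := U3.generic_t3 n G.card hn hg
  unfold U3.u0Sum U3.u1Sum U3.u2Sum U3.w3Sum at hfam
  rw [← phiK_eq_sum] at hfam
  calc phiK (n + 4) 3 * ((UqG M (n + 4) 3 G).card : ℚ)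
      ≤ phiK (n + 4) 3 * (2 ^ G.card - (1 + (G.card : ℚ) + (G.card.choose 2 : ℚ)) -
          (1 + (G.card : ℚ) + (G.card.choose 2 : ℚ))) := mul_le_mul_of_nonneg_left hdem (phiK_nonneg _ _)
    _ = phiK (n + 4) 3 * (2 ^ G.card - 2 - 2 * (G.card : ℚ) - 2 * (G.card.choose 2 : ℚ)) := by ring
    _ ≤ _ := hfam
    _ ≤ ∑ S ∈ Yq M (n + 4) 3, wPlus M G S := hsup

/-- **Type `2`** (`ρ(E ∖ G) = p − 2`): the per-flat inequality for a line-free plane with `≥ 6` points, `p ≥ 8`. -/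
theorem perFlat_lineFree_type_two {G : Finset α} (hG : G ∈ flatsQ M 3) (hfree : LineFree M G)
    (hg : 6 ≤ G.card) {n : ℕ} (hn : 4 ≤ n) (he : M.eRk ((gr M \ G : Finset α) : Set α) = ((n + 2 : ℕ) : ℕ∞)) :
    phiK (n + 4) 3 * ((UqG M (n + 4) 3 G).card : ℚ) ≤ ∑ S ∈ Yq M (n + 4) 3, wPlus M G S := by
  have hdem := card_UqG_le_of_eRk_compl G he (show n + 2 + 2 ≤ n + 4 by omega)
  rw [demandCount_eq (by omega)] at hdem
  simp only [Finset.sum_range_succ, Finset.range_zero, Finset.sum_empty, Nat.choose_zero_right,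
    Nat.choose_one_right, Nat.cast_one, zero_add] at hdem
  have hsup := supply_ge_grouped hG hfree hg (n := n) he
  have hfam := U2.generic_t2 n G.card hn hg
  unfold U2.r0Sum U2.r1Sum U2.r2Sum U2.w2Sum at hfam
  rw [← phiK_eq_sum] at hfam
  calc phiK (n + 4) 3 * ((UqG M (n + 4) 3 G).card : ℚ)
      ≤ phiK (n + 4) 3 * (2 ^ G.card - (1 + (G.card : ℚ) + (G.card.choose 2 : ℚ)) - (1 + (G.card : ℚ))) :=
        mul_le_mul_of_nonneg_left hdem (phiK_nonneg _ _)
    _ = phiK (n + 4) 3 * (2 ^ G.card - 1 - (G.card : ℚ) - (G.card.choose 2 : ℚ) - ((G.card : ℚ) + 1)) := by ring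
    _ ≤ _ := hfam
    _ ≤ ∑ S ∈ Yq M (n + 4) 3, wPlus M G S := hsup

/-- **Type `1`** (`ρ(E ∖ G) = p − 1`): the per-flat inequality for a line-free plane with `≥ 6` points, `p ≥ 8`. -/
theorem perFlat_lineFree_type_one {G : Finset α} (hG : G ∈ flatsQ M 3) (hfree : LineFree M G)
    (hg : 6 ≤ G.card) {n : ℕ} (hn : 4 ≤ n) (he : M.eRk ((gr M \ G : Finset α) : Set α) = ((n + 3 : ℕ) : ℕ∞)) :
    phiK (n + 4) 3 * ((UqG M (n + 4) 3 G).card : ℚ) ≤ ∑ S ∈ Yq M (n + 4) 3, wPlus M G S := by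
  have hdem := card_UqG_le_of_eRk_compl G he (show n + 3 + 1 ≤ n + 4 by omega)
  rw [demandCount_eq (by omega)] at hdem
  simp only [Finset.sum_range_succ, Finset.range_zero, Finset.sum_empty, Nat.choose_zero_right,
    Nat.cast_one, zero_add] at hdem
  have hsup := supply_ge_grouped hG hfree hg (n := n) he
  have hfam := U1.generic_t1 n G.card hn hg
  unfold U1.q0Sum U1.q1Sum U1.q2Sum U1.w1Sum at hfam
  rw [← phiK_eq_sum] at hfam
  calc phiK (n + 4) 3 * ((UqG M (n + 4) 3 G).card : ℚ)
      ≤ phiK (n + 4) 3 * (2 ^ G.card - (1 + (G.card : ℚ) + (G.card.choose 2 : ℚ)) - 1) :=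
        mul_le_mul_of_nonneg_left hdem (phiK_nonneg _ _)
    _ = phiK (n + 4) 3 * (2 ^ G.card - 1 - (G.card : ℚ) - (G.card.choose 2 : ℚ) - 1) := by ring
    _ ≤ _ := hfam
    _ ≤ ∑ S ∈ Yq M (n + 4) 3, wPlus M G S := hsup

/-- A plane whose complement has rank `< p − 3` has no bottom set at `(p, 3)`. -/
theorem UqG_eq_empty_of_eRk_compl_lt {G : Finset α} (hG : G ∈ flatsQ M 3) {p e : ℕ}
    (he : M.eRk ((gr M \ G : Finset α) : Set α) = e) (hlt : e + 3 < p) : UqG M p 3 G = ∅ := by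
  rw [Finset.eq_empty_iff_forall_notMem]
  intro B hB
  unfold UqG at hB
  rw [Finset.mem_filter, mem_Uq] at hB
  obtain ⟨⟨_, _, hBp⟩, hBG⟩ := hB
  have h1 := eRk_sdiff_le_add M G B (gr M)
  rw [hBp, he] at h1
  have h2 : M.eRk ((G \ B : Finset α) : Set α) ≤ 3 := by
    rw [← eRk_eq_three_of_mem_flatsQ' hG]
    exact M.eRk_mono (Finset.coe_subset.2 Finset.sdiff_subset)
  have h3 : (p : ℕ∞) ≤ ((3 + e : ℕ) : ℕ∞) := by
    have := h1.trans (add_le_add h2 le_rfl)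
    exact_mod_cast this
  have h4 : p ≤ 3 + e := by exact_mod_cast h3
  omega

/-- **`R₃⁺` certifies every line-free plane with `≥ 6` points at every `p ≥ 8`**, whatever the rank of its
complement: `Φ(p, 3) · #U_G ≤ Σ_{S ∈ Yq} w⁺(G, S)`. -/
theorem perFlat_lineFree_of_six_le {G : Finset α} (hG : G ∈ flatsQ M 3) (hfree : LineFree M G)
    (hg : 6 ≤ G.card) {p : ℕ} (hp : 8 ≤ p) :
    phiK p 3 * ((UqG M p 3 G).card : ℚ) ≤ ∑ S ∈ Yq M p 3, wPlus M G S := by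
  obtain ⟨n, rfl⟩ : ∃ n, p = n + 4 := ⟨p - 4, by omega⟩
  have hn : 4 ≤ n := by omega
  obtain ⟨e, he, _⟩ := eRk_eq_nat M (gr M \ G)
  rcases le_or_gt (n + 4) e with h0 | h0
  · exact perFlat_lineFree_of_typeZero hG hfree (n + 4) (by rw [he]; exact_mod_cast h0)
  rcases lt_or_ge (e + 3) (n + 4) with hlt | hge
  · rw [UqG_eq_empty_of_eRk_compl_lt hG he hlt, Finset.card_empty, Nat.cast_zero, mul_zero]
    exact Finset.sum_nonneg (fun S _ => wPlus_nonneg M G S)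
  · rcases (show e = n + 1 ∨ e = n + 2 ∨ e = n + 3 by omega) with h | h | h
    · exact perFlat_lineFree_type_three hG hfree hg hn (by rw [he, h])
    · exact perFlat_lineFree_type_two hG hfree hg hn (by rw [he, h])
    · exact perFlat_lineFree_type_one hG hfree hg hn (by rw [he, h])

end NightThree

end PercRepro
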